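import Summits.QuantumFields.BalabanUV.T4Continuum.Support.VariationalColourTaxiLines
import Summits.QuantumFields.BalabanUV.T4Continuum.Support.VariationalColourOneStepPhys
import Summits.QuantumFields.BalabanUV.T4Continuum.Support.VariationalColourUpperBoundData

/-!
# T⁴ programme, spine node NE2 (U1a), lane P2 — SUPPLIER ITEM «V-COL-TAXI», part 3: THE ONE-STEP COLOUR LEAVES AT TAXI DATA — FED⁺-colour, UB⁺-colour and
# ONE⁺-colour with EVERY transport binder discharged: unitary bond operators and their operator plaquette defect are the only data left

NE2 formalisation swarm `b2b-balaban-t4-ne2-formalise-*`, leaf prover 04 GEN 4 (`prover-b2b-balaban-t4-ne2-formalise-leaf-04-g4-0`); register row «P2-sup» of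
`t4/formal/NE2/LEAVES.md`; journal CLAIMS.log «V-COL-TAXI part 3».  One-liners on top of parts 1–2 (`taxiTv`, `coarseTv`, `norm_misv_taxi_le`,
`inBlock_defect_taxiTv_adjoint_le`, `hin_taxiTv_le`, `hcross_taxiTv_le`) and of the colour leaves of record BY NAME: leaf-02-g4's FED⁺-colour
`VariationalColourFederbush.dirUv_Qcv_le_of_unitary` and `VariationalColourScalarPair.Scv_Q1v_le` (the `hFED` slot of `colour_pair_bracket`), UB⁺-colour
`VariationalColourUpperBound.blockSpin_colour_le_of_unitary` (p·UpperBoundData), leaf-09-g4's ONE⁺-colour `VariationalColourOneStepPhys.blockSpin_Q1v_le`.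

THE STATEMENTS (one block step `Tor (fine L N)` over `Tor N`, resp. `Tor (fine L (fine n M))` over `Tor (fine n M)`; `H` a Hilbert space; bond operators `R′(x,μ)`
UNITARY with operator plaquette defect `‖R′(x,κ)R′(x+e_κ,ι) − R′(x,ι)R′(x+e_ι,κ)‖ ≤ a`; site transports `taxiTv R′`, coarse bonds `coarseTv R′`):
 * **`dirUv_Qcv_taxi_le`** (FED⁺-colour): `Σ_y‖(D_{coarseTv R′} Q_{taxiTv R′} f′)(y,μ)‖² ≤ (√(L²·X_μ∕L^d) + (d−1)L(L−1)a·√(Σ‖f′‖²∕L^d))²`;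
   **`Scv_Q1v_taxi_le`** (the pair's `hFED` slot, physical units): `Scv n M (coarseTv R′) (Q1v (taxiTv R′) f′) ≤ (√(Sfv n L M R′ f′) + √d·(n·(d−1)L(L−1)a)·√(qVv f′))²`;
 * **`blockSpin_colour_taxi_le`** (UB⁺-colour, one blocking of factor `L` with the straight taxi): `Δ′(φ) ≤ 2d·36^d·((1 + L·(d−1)(L−1)a)² + 9)·Σ‖φ‖²`;
 * **`blockSpin_Q1v_taxi_le`** (ONE⁺-colour): `blockSpin (Q1v (taxiTv R′)) (Sfv R′) λ ≤ (√(Scv (coarseTv R′) λ + (d∕4+½)(L∕n²)·rhov (coarseTv R′) λ) + √(2d(1+d²))·(nL·m)·√(qWv λ))²`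
   with `m = (d−1)(L−1)(2L−1)·a` (the larger of part 2's `m_in`, `m_cross`).
Honest sizes under the scale-invariant class `(nL)²·a ≤ c`: `n·(d−1)L(L−1)a ≤ d·c∕n`, `nL·m ≤ 2d·c∕n` — geometric along the tower.
WHAT IS NOT HERE (stated, not hidden): the coarse-level UB⁺ ∕ P⁺ ∕ REG⁺ of the PAIR at level `k` (their site transports are the NESTED operator taxi over `k`
steps — gen 3's `nestT` pattern in operators, a later file), P⁺-colour and REG⁺-colour themselves (open leaves), `colour_pair_bracket` at taxi data, the END.

HONEST FRAMING (T4-DAG p. 1).  Instantiation only, at MODEL level (unitary bond operators DATA; taxi ∕ straight contours OURS; SHAPES [Balaban1985BackgroundPropagators]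
(3.10) ∕ (3.15) ∕ (3.19) only, no B0, c5); nothing printed is a hypothesis; no `def`, no `def … : Prop`, no `sorry`; axioms standard.  NE2 NOT proved on either road; NE3
OPEN; spine PROVED 0∕9 unchanged; rung (B)+1 finite T⁴ — NOT infinite volume, NOT mass gap, NOT Clay.  HONEST DEPENDENCY (cell, verbatim): continuum YM on T⁴ ⇐
BetaPertH ∧ nine spine estimates (0/9 proved); BetaPertH ⇐ (D1) ∧ (D4) ∧ CAP+tail; G-an2-4 gates asym, D1 and NE2/3/4.
-/

noncomputable section

namespace Summit.QuantumFields.BalabanUV.T4Continuum.VariationalColourTaxiTransport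

open Finset
open Literature.MathematicalPhysics.QuantumFieldTheory.Balaban1983to89.B5Prop11Plancherel (Tor fine unitVec)
open Summit.QuantumFields.BalabanUV.T4Continuum.VariationalTransfer (blockSpin)
open Summit.QuantumFields.BalabanUV.T4Continuum.VariationalColourFederbush (cDv dirUv Qcv misv norm_le_one_of_mem_unitary dirUv_Qcv_le_of_unitary)
open Summit.QuantumFields.BalabanUV.T4Continuum.VariationalColourUpperBound (nsqv blockSpin_colour_le_of_unitary)
open Summit.QuantumFields.BalabanUV.T4Continuum.VariationalColourScalarPair (Scv Sfv qWv qVv Q1v Scv_Q1v_le)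
open Summit.QuantumFields.BalabanUV.T4Continuum.VariationalColourOneStepPhys (rhov blockSpin_Q1v_le)

variable {d : ℕ}

/-! ## §1 FED⁺-colour at taxi data -/

section Hilbert

variable {H : Type*} [NormedAddCommGroup H] [InnerProductSpace ℂ H]

section FEDPair

variable (n L : ℕ) [NeZero n] [NeZero L] (M : Fin d → ℕ) [hM : ∀ μ, NeZero (M μ)]

/-- **THE PAIR'S `hFED` SLOT AT TAXI DATA** (physical units, inner-product space `H`): `VariationalColourScalarPair.Scv_Q1v_le` with `Rc := coarseTv R′`,
`T′ := taxiTv R′`, `m := (d−1)L(L−1)·a` (part 1's `norm_misv_taxi_le`); contractive bonds suffice. [folklore] -/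
theorem Scv_Q1v_taxi_le {R' : Tor (fine L (fine n M)) → Fin d → (H →L[ℂ] H)} (hR' : ∀ x μ, ‖R' x μ‖ ≤ 1) {a : ℝ} (ha0 : 0 ≤ a)
    (ha : ∀ x κ ι, ‖R' x κ * R' (x + unitVec (fine L (fine n M)) κ) ι - R' x ι * R' (x + unitVec (fine L (fine n M)) ι) κ‖ ≤ a)
    (f' : Tor (fine L (fine n M)) → H) :
    Scv n M (coarseTv L (fine n M) R') (Q1v n L M (taxiTv L (fine n M) R') f')
      ≤ (Real.sqrt (Sfv n L M R' f') + Real.sqrt d * ((n : ℝ) * (((d - 1 : ℕ) : ℝ) * L * ((L - 1 : ℕ) : ℝ) * a)) * Real.sqrt (qVv n L M f')) ^ 2 :=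
  Scv_Q1v_le n L M hR' (norm_taxiTv_le_one L (fine n M) hR') (by positivity) (norm_misv_taxi_le L (fine n M) hR' ha) f'

end FEDPair

section Complete

variable [CompleteSpace H]

section FED

variable (L : ℕ) [NeZero L] (N : Fin d → ℕ) [hN : ∀ μ, NeZero (N μ)]

/-- **FED⁺-COLOUR AT TAXI DATA** (lattice units): `VariationalColourFederbush.dirUv_Qcv_le_of_unitary` with `Rc := coarseTv R′`, `T′ := taxiTv R′`,
`m := (d−1)L(L−1)·a` (part 1's `norm_misv_taxi_le`) — unitary bonds and the plaquette defect are the only binders. [folklore] -/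
theorem dirUv_Qcv_taxi_le {R' : Tor (fine L N) → Fin d → (H →L[ℂ] H)} (hU : ∀ x μ, R' x μ ∈ unitary (H →L[ℂ] H)) {a : ℝ} (ha0 : 0 ≤ a)
    (ha : ∀ x κ ι, ‖R' x κ * R' (x + unitVec (fine L N) κ) ι - R' x ι * R' (x + unitVec (fine L N) ι) κ‖ ≤ a) (f' : Tor (fine L N) → H) (μ : Fin d) :
    dirUv N (coarseTv L N R') (Qcv L N (taxiTv L N R') f') μ
      ≤ (Real.sqrt ((L : ℝ) ^ 2 * dirUv (fine L N) R' f' μ / (L : ℝ) ^ d)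
          + ((d - 1 : ℕ) : ℝ) * L * ((L - 1 : ℕ) : ℝ) * a * Real.sqrt ((∑ x, ‖f' x‖ ^ 2) / (L : ℝ) ^ d)) ^ 2 :=
  dirUv_Qcv_le_of_unitary L N hU (taxiTv_mem_unitary L N hU) (by positivity)
    (norm_misv_taxi_le L N (fun x μ => norm_le_one_of_mem_unitary (hU x μ)) ha) f' μ

end FED

section Pair

variable (n L : ℕ) [NeZero n] [NeZero L] (M : Fin d → ℕ) [hM : ∀ μ, NeZero (M μ)]

/-! ## §2 UB⁺-colour and ONE⁺-colour at taxi data (unitary bonds) -/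

variable {R' : Tor (fine L (fine n M)) → Fin d → (H →L[ℂ] H)} (hU : ∀ x μ, R' x μ ∈ unitary (H →L[ℂ] H)) {a : ℝ} (ha0 : 0 ≤ a)
  (ha : ∀ x κ ι, ‖R' x κ * R' (x + unitVec (fine L (fine n M)) κ) ι - R' x ι * R' (x + unitVec (fine L (fine n M)) ι) κ‖ ≤ a)
include hU ha0 ha

/-- **UB⁺-COLOUR AT TAXI DATA** (one blocking of factor `L`, straight taxi, lattice units of the fine torus):
`VariationalColourUpperBound.blockSpin_colour_le_of_unitary` with `U := taxiTv R′`, `w := (d−1)(L−1)·a` (part 2's `inBlock_defect_taxiTv_adjoint_le`). [folklore] -/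
theorem blockSpin_colour_taxi_le (φ : Tor (fine n M) → H) :
    blockSpin (Qcv L (fine n M) (taxiTv L (fine n M) R')) (fun f => ((L : ℝ) ^ d)⁻¹ * ((L : ℝ) ^ 2 * ∑ μ, dirUv (fine L (fine n M)) R' f μ)) φ
      ≤ 2 * d * (36 : ℝ) ^ d * ((1 + L * (((d - 1 : ℕ) : ℝ) * ((L - 1 : ℕ) : ℝ) * a)) ^ 2 + 9) * nsqv φ :=
  blockSpin_colour_le_of_unitary L (fine n M) (taxiTv_mem_unitary L (fine n M) hU) hU (by positivity)
    (inBlock_defect_taxiTv_adjoint_le L (fine n M) hU ha) φ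

/-- **ONE⁺-COLOUR AT TAXI DATA** (physical units): `VariationalColourOneStepPhys.blockSpin_Q1v_le` with `T′ := taxiTv R′`, `Rc := coarseTv R′`,
`m := (d−1)(L−1)(2L−1)·a` (part 2's `hin_taxiTv_le` ∕ `hcross_taxiTv_le`; `m_in ≤ m_cross`). [folklore] -/
theorem blockSpin_Q1v_taxi_le (lam : Tor (fine n M) → H) :
    blockSpin (Q1v n L M (taxiTv L (fine n M) R')) (Sfv n L M R') lam
      ≤ (Real.sqrt (Scv n M (coarseTv L (fine n M) R') lam + ((d : ℝ) / 4 + 1 / 2) * ((L : ℝ) / (n : ℝ) ^ 2) * rhov n M (coarseTv L (fine n M) R') lam)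
          + Real.sqrt (2 * d * (1 + (d : ℝ) ^ 2)) * ((n : ℝ) * L * (((d - 1 : ℕ) : ℝ) * ((L - 1 : ℕ) : ℝ) * ((2 * L - 1 : ℕ) : ℝ) * a))
            * Real.sqrt (qWv n M lam)) ^ 2 := by
  have hmono : ((d - 1 : ℕ) : ℝ) * ((L - 1 : ℕ) : ℝ) * a ≤ ((d - 1 : ℕ) : ℝ) * ((L - 1 : ℕ) : ℝ) * ((2 * L - 1 : ℕ) : ℝ) * a := by
    have h1 : (1 : ℝ) ≤ ((2 * L - 1 : ℕ) : ℝ) := by have := NeZero.pos L; exact_mod_cast (show 1 ≤ 2 * L - 1 by omega)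
    have h0 : 0 ≤ ((d - 1 : ℕ) : ℝ) * ((L - 1 : ℕ) : ℝ) * a := by positivity
    nlinarith
  exact blockSpin_Q1v_le n L M (taxiTv_mem_unitary L (fine n M) hU) (coarseTv_mem_unitary L (fine n M) hU) (by positivity)
    (fun y j μ h => (hin_taxiTv_le L (fine n M) hU ha y j μ h).trans hmono) (fun y j μ h => hcross_taxiTv_le L (fine n M) hU ha y j μ h) lam

end Pair

end Complete

end Hilbert

end Summit.QuantumFields.BalabanUV.T4Continuum.VariationalColourTaxiTransport

end
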